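import Mathlib.GroupTheory.OrderOfElement
import Mathlib.Data.ZMod.Basic
import HarnessLib.Audit
import HarnessLib

/-!
# Route `ResidualThetaTransportAtTwo` — definition file: ARTIN'S PRIMITIVE-ROOT CONJECTURE FOR THE BASE `2` IN ARITHMETIC
# PROGRESSIONS `r mod m`, `r ≡ 3 (mod 8)` (a THEOREM under GRH — Hooley 1967 / Lenstra 1977 / Moree 1999; OPEN unconditionally)

Cell `bsd-wall`, width seat `bsd-wall-rtt-p3-w4` (g0), crux Kan⁺ `ThetaLayerLambdaCongruenceAtTwo` (stmt-BirchSwinnertonDyer-20688),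
line `birth`. ONE definition (a `Prop`; no instance, no notation, nothing asserted): the classical hypothesis under which the
curve-free node `SignedMuAtTwo.CuspSpanEvenAtTwo N` ((G′)_N, `…CuspSpanDefs`) is proved for EVERY odd level `N` in the sequel
`…ThetaLayerLambdaCongruenceAtTwoCuspSpanArtin` (lead `bsd-wall-rtt-p3` g9's sketch `Cruxes/…/Lines/birth-generation.md` §4.2, made
a kernel theorem there). Per the cell convention conjectures are `@[conjecture] def`s under `Theorems`, never Literature facts.

STATEMENT. For every modulus `m` divisible by `8` and every `r` prime to `m` with `r ≡ 3 (mod 8)` there are arbitrarily large primes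
`q ≡ r (mod m)` for which `2` is a primitive root (`orderOf (2 : ZMod q) = q − 1`).

STATUS. A THEOREM under the Riemann hypothesis for the Dedekind zeta functions of the fields `ℚ(ζ_m, ζ_n, 2^{1/n})` (`n` squarefree):
Lenstra's theorem ([Moree2012ArtinSurvey] Thm. 1 = [Lenstra1977Artin] Thm. 8.3) gives the density
`δ(r, m, 2) = ∑ μ(n) c_r(n) / [ℚ(ζ_m, ζ_n, 2^{1/n}) : ℚ]` of such primes, and Moree's Euler product ([Moree2012ArtinSurvey] Thm. 2 =
[Moree1999PrimesAP]) shows `δ(r, m, 2) > 0` exactly when the progression does not force `(2/q) = +1`; for `8 ∣ m`, `r ≡ ±3 (mod 8)`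
every `q ≡ r (mod m)` has `(2/q) = −1`, so there is no obstruction. UNCONDITIONALLY OPEN — already for `m = 8` it contains Artin's
conjecture for the base `2` (Heath-Brown 1986: at most two prime bases fail, unspecified). Hence conjecture-grade here: a `def … : Prop`
only, no `_holds` is claimed; users take `(hA : ArtinPrimitiveRootTwoAP)`. BSD is not proved by this; nothing is asserted.

References: [Moree2012ArtinSurvey] P. Moree, *Artin's primitive root conjecture — a survey*, Integers 12 (2012), Thms. 1–2;
[Lenstra1977Artin] H. W. Lenstra, *On Artin's conjecture and Euclid's algorithm in global fields*, Invent. Math. 42 (1977), Thm. 8.3;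
[Moree1999PrimesAP] P. Moree, J. Number Theory 78 (1999).
-/

set_option autoImplicit false
set_option linter.dupNamespace false

namespace Summit.BirchSwinnertonDyer.BirchSwinnertonDyer.Theorems.SignedMuAtTwo

/-- **Artin's primitive-root conjecture for the base `2` in the progressions `r mod m`, `8 ∣ m`, `r ≡ 3 (mod 8)`** (qualitative
form): for every such coprime progression and every bound `B` there is a prime `q > B`, `q ≡ r (mod m)`, with `2` a primitive root
mod `q` (`orderOf (2 : ZMod q) = q − 1`). A theorem under GRH [cite: Moree2012ArtinSurvey, Thm. 1 (Lenstra) and Thm. 2]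
[cite: Lenstra1977Artin, Thm. 8.3]; open unconditionally (it contains Artin's conjecture for `2`). Definition only — nothing is
asserted; the hypothesis of `cuspSpanEvenAtTwo_of_artin`. (CONJECTURE-grade; `@[conjecture]`.) -/
@[conjecture] def ArtinPrimitiveRootTwoAP : Prop :=
  ∀ m r : ℕ, 8 ∣ m → r % 8 = 3 → Nat.Coprime r m →
    ∀ B : ℕ, ∃ q : ℕ, B < q ∧ q.Prime ∧ q % m = r % m ∧ orderOf (2 : ZMod q) = q - 1

/-- Unfolding `ArtinPrimitiveRootTwoAP` (definitional). [folklore] -/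
theorem artinPrimitiveRootTwoAP_iff :
    ArtinPrimitiveRootTwoAP ↔ ∀ m r : ℕ, 8 ∣ m → r % 8 = 3 → Nat.Coprime r m →
      ∀ B : ℕ, ∃ q : ℕ, B < q ∧ q.Prime ∧ q % m = r % m ∧ orderOf (2 : ZMod q) = q - 1 :=
  Iff.rfl

end Summit.BirchSwinnertonDyer.BirchSwinnertonDyer.Theorems.SignedMuAtTwo
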